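import Literature.AlgebraicGeometry.Limits.SubalgebraEndomorphismRingSpread
import Literature.AlgebraicGeometry.HodgeTheory.SpreadingOutQbarFamilyProofs
import Literature.AlgebraicGeometry.Motives.AbelianVarietyProjectiveChart
import Literature.AlgebraicGeometry.AbelianSchemes.AbelianSchemeRingActionLie
import Mathlib.FieldTheory.AlgebraicClosure
import HarnessLib

/-!
# A complex abelian variety with an action of an order spreads out to an abelian scheme over a finitely generated
# `ℚ̄`-subalgebra of `ℂ` (Shimura 1998 §12.4 Prop. 26 and its proof p. 96; Milne CM Cor. 7.10 p. 54; EGA IV₃ 8.8.2, 8.10.5, IV₄ 17.7.8)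

Topic `Literature/AlgebraicGeometry/AbelianSchemes`; namespace `Literature.AlgebraicGeometry.AbelianSchemes.AbelianScheme`.
Cell `hodgecm-mathlib` (D-0151), row II-2β (`shimura1998_prop26_definedOverQbar` `_holds` programme, plan of record
`A-provers/A-p03/PREP-II2beta-Prop26Qbar.md`), step (S1) «spread the structure `(A, ι)` over a finitely generated `ℚ̄`-subalgebra
of `ℂ`» (A-p14, S1 lead).  THEOREMS ONLY (no definition, no named fact, no instance; net debt 0).

THE PRINT.  [Shimura1998] §12.4 Prop. 26 and its proof (p. 96): «We may assume that k is a finitely generated extension of Q containing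
k₀» (then reduction at a place of k over k₀, loc. cit.); [MilneCM2006] Cor. 7.10 (p. 54) with Prop. 7.9's proof by specialization (7.7 + 3.13): the reading
used here is that `(A, i)` extends to an abelian scheme with `𝓞`-action over a finitely generated `ℚ̄`-algebra `R ⊂ ℂ`.  The algebraic geometry is
EGA IV₃ 8.8.2 / 8.10.5 and IV₄ 17.7.8, all PROVED in the tree and only ASSEMBLED here:
* the underlying smooth projective variety spreads out: `HodgeTheory.SpreadingOutQbar.exists_smooth_projective_spread` (over a
  finitely generated `ℚ̄`-domain `T ⊆ ℂ`, proper, smooth, geometrically irreducible fibres, `A ≅ Y ×_T Spec ℂ`);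
* the (commutative) group law and the action of the order `O` (free of finite rank over `ℤ`) by homomorphisms descend TOGETHER to a
  stage `T′ = T[t] ⊆ ℂ` of the subalgebra diagram `Spec ℂ = lim Spec T[t]`:
  `Limits.SubalgGrpSpread.exists_stage_forall_grpObj_ringAction` (A-p14, `Limits/SubalgebraEndomorphismRingSpread`);
* packaging: the stage is an `AbelianScheme T′` (tree carrier `AbelianSchemes/AbelianSchemeAffineBase`), its fibre along
  `ψ : T′ ↪ ℂ` is `A` as an abelian variety (`AbelianScheme.fibre`, A-p11) and the descended action specialises along `ψ` to `ι`
  (`AbelianScheme.fibreEnd`).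

RESULT `exists_abelianScheme_ringAction_fibre_iso`: for `A : AbelianVariety ℂ` and `ι : O →+* End A` there are a finitely generated
`ℚ̄`-DOMAIN `T′` with an INJECTIVE `ℚ̄`-algebra map `ψ : T′ → ℂ`, an abelian scheme `𝒜/T′` with commutative group law, a presented
action `ι_{T′} : O → End_{T′}(𝒜)` by homomorphisms (`ι_{T′} 1 = 𝟙`, `ι_{T′}(ab) = ι_{T′} a ∘ ι_{T′} b`, `ι_{T′}(a + b) = ι_{T′} a · ι_{T′} b`),
and an isomorphism of complex abelian varieties `𝒜_ψ ≅ A` carrying `(ι_{T′} a)_ψ` to `ι a`.  Consumers: A-p11 `exists_ringHom_fibreEnd`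
(the specialised structure `(𝒜_u, ι_u)` at a `ℚ̄`-point `u`, `CMStructureSpecialisationAlgebra`), A-p03 (type of the fibre via the
unit-section cotangent), B-p06 (`CMDefinedOverQbarOfModel`).  HC_CM is proved only modulo the 7 printed citations until rung 0 closes.

## References
* [Shimura1998] G. Shimura, *Abelian Varieties with Complex Multiplication and Modular Functions* (1998), §12.4 Prop. 26 and its proof, p. 96.
* [MilneCM2006] J. S. Milne, *Complex Multiplication* (2006; v0.10 2020), Ch. II Cor. 7.10 and its proof, p. 54.
* [EGAIV3] A. Grothendieck, EGA IV₃ (Publ. Math. IHÉS 28, 1966), Thm. 8.8.2, Thm. 8.10.5.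
* [Milne1986AbelianVarieties] J. S. Milne, *Abelian Varieties* (1986), §20, Rem. 20.9.
-/

set_option autoImplicit false

noncomputable section

open CategoryTheory CategoryTheory.Limits AlgebraicGeometry MonoidalCategory CartesianMonoidalCategory MonObj

namespace Literature.AlgebraicGeometry.AbelianSchemes.AbelianScheme

open Literature.AlgebraicGeometry.Motives
open Literature.AlgebraicGeometry.Limits Literature.AlgebraicGeometry.Limits.SubalgApprox
  Literature.AlgebraicGeometry.Limits.SubalgGrpSpread
open Literature.AlgebraicGeometry.HodgeTheory

set_option backward.isDefEq.respectTransparency false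

/-! ## §1 Two small transports -/

/-- Geometrically irreducible morphisms are geometrically connected. [folklore] -/
private theorem geometricallyConnected_of_geometricallyIrreducible {X Y : Scheme} (f : X ⟶ Y)
    [h : GeometricallyIrreducible f] : GeometricallyConnected f :=
  ⟨fun _ _ y _ fst snd hpb => by
    haveI : IrreducibleSpace _ := h.geometrically_irreducibleSpace y fst snd hpb
    infer_instance⟩

universe v' u' in
/-- Transport of commutativity of a monoid object along `MonObj.ofIso`. [folklore] -/
private theorem isCommMonObj_ofIso' {C : Type u'} [Category.{v'} C] [MonoidalCategory C] [BraidedCategory C]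
    {M X : C} [MonObj M] [IsCommMonObj M] (e : M ≅ X) : letI := MonObj.ofIso e; IsCommMonObj X := by
  letI := MonObj.ofIso e
  refine { mul_comm := ?_ }
  rw [MonObj.ofIso_mul, ← Category.assoc, ← BraidedCategory.braiding_naturality, Category.assoc,
    IsCommMonObj.mul_comm_assoc]

/-! ## §2 The spread of `(A, ι)` as an abelian scheme over a finitely generated `ℚ̄`-subalgebra of `ℂ` -/

/-- **Spreading out a complex abelian variety with an action of an order** (Shimura §12.4 Prop. 26 and its proof p. 96: «We may assume that k is a
finitely generated extension of Q»; Milne CM Cor. 7.10 p. 54 with Prop. 7.9's proof; EGA IV₃ 8.8.2 / 8.10.5, IV₄ 17.7.8).  Let `A` be an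
abelian variety over `ℂ` and `ι : O → End A` an action of a commutative ring `O` whose additive group is free of finite rank (e.g.
`O = 𝓞_K`).  Then there are: a finitely generated `ℚ̄`-algebra `T′` (`ℚ̄ = algebraicClosure ℚ ℂ`) which is a domain, with an
INJECTIVE `ℚ̄`-algebra map `ψ : T′ → ℂ`; an abelian scheme `𝒜` over `T′` whose group law is commutative; a presented
action `ι_{T′} : O → (𝒜 ⟶ 𝒜)` by group-scheme endomorphisms (`AbelianScheme.RingAction`: `ι_{T′} 1 = 𝟙`,
`ι_{T′} (ab) = ι_{T′} a ≫ ι_{T′} b`, `ι_{T′} (a + b) = ι_{T′} a · ι_{T′} b`); and an isomorphism of complex abelian varieties `e : 𝒜_ψ ≅ A`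
(the fibre of `𝒜` along `ψ`, `AbelianScheme.fibre`) with `(ι_{T′} a)_ψ ≫ e = e ≫ ιA a` for all `a` (`AbelianScheme.fibreEnd`).
Construction: the smooth projective spread `Y → Spec T` of the variety `A` (`exists_smooth_projective_spread`), then descent of the
group law and of the action of a `ℤ`-basis of `O` to a stage `T′ = T[t]` of `Spec ℂ = lim_t Spec T[t]`
(`exists_stage_forall_grpObj_ringAction`). [cite: Shimura1998, §12.4 Prop. 26 and its proof p. 96] [cite: MilneCM2006, Cor. 7.10 and its proof p. 54]
[cite: EGAIV3, Thm. 8.8.2 and Thm. 8.10.5] [cite: Milne1986AbelianVarieties, §20 Rem. 20.9] -/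
theorem exists_abelianScheme_ringAction_fibre_iso (A : AbelianVariety ℂ) {O : Type} [CommRing O]
    [Module.Free ℤ O] [Module.Finite ℤ O] (ιA : O →+* End A) :
    ∃ (T' : Type) (_ : CommRing T') (_ : IsDomain T') (_ : Algebra (algebraicClosure ℚ ℂ) T')
      (_ : Algebra.FiniteType (algebraicClosure ℚ ℂ) T') (ψ : T' →ₐ[algebraicClosure ℚ ℂ] ℂ)
      (_ : Function.Injective ψ) (𝒜 : AbelianScheme T') (act : RingAction O 𝒜) (e : 𝒜.fibre ψ.toRingHom ≅ A),
      IsCommMonObj 𝒜.X ∧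
        ∀ a, (haveI := act.isMonHom; 𝒜.fibreEnd ψ.toRingHom (act.ιR a)) ≫ e.hom = e.hom ≫ ιA a := by
  classical
  -- `ℚ̄ ⊆ ℂ` and the smooth projective spread of the underlying variety
  obtain ⟨T, _, _, _, _, ψ₀, hψ₀, hinj, N, Y, g, emb, _, π, -, -, hpr, hsm, hgi, hpb⟩ :=
    SpreadingOutQbar.exists_smooth_projective_spread (k := ↥(algebraicClosure ℚ ℂ)) (K := ℂ)
      (AbelianVariety.isSmoothProjective_holds (A := A))
  letI : Algebra T ℂ := ψ₀.toAlgebra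
  haveI : IsScalarTower (↥(algebraicClosure ℚ ℂ)) T ℂ :=
    IsScalarTower.of_algebraMap_eq fun x => (RingHom.congr_fun hψ₀ x).symm
  -- the model as a `T`-scheme
  let P : SchemeOver T := Over.mk g
  haveI : IsProper P.hom := hpr
  haveI := hsm
  haveI : Smooth P.hom := SmoothOfRelativeDimension.smooth A.dim g
  haveI : GeometricallyIrreducible P.hom := hgi
  haveI : QuasiCompact P.hom := inferInstance
  haveI : IsSeparated P.hom := inferInstance
  haveI : Flat P.hom := inferInstance
  haveI : LocallyOfFinitePresentation P.hom := inferInstance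
  -- `A ≅ Y ×_T Spec ℂ` as `ℂ`-schemes (both viewed in the category `Over (Spec ℂ)` of the limit `Spec ℂ = lim Spec T[t]`);
  -- the transported (commutative) group law on `Y ×_T Spec ℂ`
  let XA : Over (specOver T ℂ).left := A.X
  letI : GrpObj XA := A.grpObj
  haveI : IsCommMonObj XA := AbelianVariety.instIsCommMonObj A
  let e₁ : XA ≅ limObj ℂ P := Over.isoMk hpb.isoPullback hpb.isoPullback_hom_snd
  letI : GrpObj (limObj ℂ P) := GrpObj.ofIso e₁
  haveI : IsCommMonObj (limObj ℂ P) := isCommMonObj_ofIso' e₁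
  haveI : IsMonHom e₁.hom := isMonHom_ofIso e₁
  haveI : IsMonHom e₁.inv := inferInstance
  -- the transported action `ι_B a = e₁⁻¹ ∘ ι a ∘ e₁`
  let ιX : O → (XA ⟶ XA) := fun a => (ιA a).hom.hom.hom
  haveI hmonX : ∀ a, IsMonHom (ιX a) := fun a => (ιA a).hom.hom.isMonHom_hom
  let ιB : O → (limObj ℂ P ⟶ limObj ℂ P) := fun a => e₁.inv ≫ ιX a ≫ e₁.hom
  haveI hmonB : ∀ a, IsMonHom (ιB a) := fun a => by dsimp only [ιB]; infer_instance
  have hX1 : ιX 1 = 𝟙 XA := by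
    change (ιA 1).hom.hom.hom = 𝟙 A.X
    rw [ιA.map_one]; rfl
  have hXmul : ∀ a b, ιX (a * b) = ιX a ≫ ιX b := fun a b => by
    change (ιA (a * b)).hom.hom.hom = (ιA a).hom.hom.hom ≫ (ιA b).hom.hom.hom
    rw [mul_comm, ιA.map_mul, CategoryTheory.End.mul_def]; rfl
  have hXadd : ∀ a b, ιX (a + b) = ιX a * ιX b := fun a b => by
    change (ιA (a + b)).hom.hom.hom = (ιA a).hom.hom.hom * (ιA b).hom.hom.hom
    rw [ιA.map_add]; rfl
  have h1 : ιB 1 = 𝟙 _ := by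
    dsimp only [ιB]; rw [hX1, Category.id_comp, Iso.inv_hom_id]
  have hmul : ∀ a b, ιB (a * b) = ιB a ≫ ιB b := fun a b => by
    dsimp only [ιB]; rw [hXmul]; simp only [Category.assoc, Iso.hom_inv_id_assoc]
  have hadd : ∀ a b, ιB (a + b) = ιB a * ιB b := fun a b => by
    dsimp only [ιB]; rw [hXadd, MonObj.mul_comp, MonObj.comp_mul]
  -- descent of the group law and of the action to a stage
  obtain ⟨t₁, -, H⟩ := exists_stage_forall_grpObj_ringAction ℂ (∅ : Finset ℂ) P ιB h1 hmul hadd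
    (Opposite.op default)
  obtain ⟨G, ιt, hcomm, hmon, h1t, hmult, haddt, hiso, hkey⟩ := H t₁ (𝟙 _)
  -- the stage `T′ = T[t₁] ⊆ ℂ` and the abelian scheme
  letI : GrpObj (stageObj ℂ ∅ P t₁) := G
  let 𝒜 : AbelianScheme ↥(sub T ℂ t₁.unop.1) :=
    { X := stageObj ℂ ∅ P t₁
      isProper := inferInstanceAs (IsProper (pullback.snd P.hom ((baseDiagram T ℂ ∅).obj t₁).hom))
      isSmooth := inferInstanceAs (Smooth (pullback.snd P.hom ((baseDiagram T ℂ ∅).obj t₁).hom))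
      geometricallyConnected := by
        haveI : GeometricallyIrreducible (stageObj ℂ ∅ P t₁).hom :=
          inferInstanceAs (GeometricallyIrreducible (pullback.snd P.hom ((baseDiagram T ℂ ∅).obj t₁).hom))
        exact geometricallyConnected_of_geometricallyIrreducible _ }
  let ψ : ↥(sub T ℂ t₁.unop.1) →ₐ[algebraicClosure ℚ ℂ] ℂ := (sub T ℂ t₁.unop.1).val.restrictScalars _
  -- the fibre along `ψ` is `(Y_{t₁})_ℂ ≅ Y_ℂ ≅ A` (group structure induced by base change on the left, `A`'s on the right)
  letI : GrpObj ((legPullback T ℂ ∅ t₁).obj (stageObj ℂ ∅ P t₁)) :=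
    Functor.grpObjObj (F := legPullback T ℂ ∅ t₁) (G := stageObj ℂ ∅ P t₁)
  haveI : IsMonHom (legFacObjIso ℂ ∅ t₁ P).hom := hiso
  let eX' : (legPullback T ℂ ∅ t₁).obj (stageObj ℂ ∅ P t₁) ≅ XA := legFacObjIso ℂ ∅ t₁ P ≪≫ e₁.symm
  haveI hmonE : IsMonHom eX'.hom := by
    change IsMonHom ((legFacObjIso ℂ ∅ t₁ P).hom ≫ e₁.inv)
    infer_instance
  let eX : (𝒜.fibre ψ.toRingHom).X ≅ A.X := eX'
  haveI : IsMonHom eX.hom := hmonE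
  let e : 𝒜.fibre ψ.toRingHom ≅ A := InducedCategory.isoMk (Grp.mkIso' eX)
  refine ⟨↥(sub T ℂ t₁.unop.1), inferInstance, inferInstance, inferInstance,
    Algebra.FiniteType.trans (S := T) inferInstance inferInstance, ψ, Subtype.val_injective, 𝒜,
    ⟨ιt, hmon, h1t, hmult, haddt⟩, e, hcomm, fun a => ?_⟩
  apply AbelianVariety.hom_ext
  change (legPullback T ℂ ∅ t₁).map (ιt a) ≫ ((legFacObjIso ℂ ∅ t₁ P).hom ≫ e₁.inv) =
    ((legFacObjIso ℂ ∅ t₁ P).hom ≫ e₁.inv) ≫ ιX a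
  rw [hkey a]
  simp only [ιB, Category.assoc, Iso.inv_hom_id_assoc, Iso.hom_inv_id, Category.comp_id]

/-- **The same spread, recording the relative dimension**: the abelian scheme `𝒜/T′` of
`exists_abelianScheme_ringAction_fibre_iso` is of relative dimension `dim A` (`AbelianScheme.IsOfRelDim`; the spread
`Y → Spec T` is smooth of relative dimension `dim A` and relative dimension is stable under base change), so that every fibre
`𝒜_φ` has dimension `dim A` — the bookkeeping `[K : ℚ] = 2 dim 𝒜_u` needed to read the CM type of the specialised structure.
[cite: Shimura1998, §12.4 Prop. 26 and its proof p. 96] [cite: MilneCM2006, Cor. 7.10 and its proof p. 54] [cite: EGAIV3, Thm. 8.8.2 and Thm. 8.10.5] -/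
theorem exists_abelianScheme_relDim_ringAction_fibre_iso (A : AbelianVariety ℂ) {O : Type} [CommRing O]
    [Module.Free ℤ O] [Module.Finite ℤ O] (ιA : O →+* End A) :
    ∃ (T' : Type) (_ : CommRing T') (_ : IsDomain T') (_ : Algebra (algebraicClosure ℚ ℂ) T')
      (_ : Algebra.FiniteType (algebraicClosure ℚ ℂ) T') (ψ : T' →ₐ[algebraicClosure ℚ ℂ] ℂ)
      (_ : Function.Injective ψ) (𝒜 : AbelianScheme T') (act : RingAction O 𝒜) (e : 𝒜.fibre ψ.toRingHom ≅ A),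
      𝒜.IsOfRelDim A.dim ∧ IsCommMonObj 𝒜.X ∧
        ∀ a, (haveI := act.isMonHom; 𝒜.fibreEnd ψ.toRingHom (act.ιR a)) ≫ e.hom = e.hom ≫ ιA a := by
  classical
  -- `ℚ̄ ⊆ ℂ` and the smooth projective spread of the underlying variety
  obtain ⟨T, _, _, _, _, ψ₀, hψ₀, hinj, N, Y, g, emb, _, π, -, -, hpr, hsm, hgi, hpb⟩ :=
    SpreadingOutQbar.exists_smooth_projective_spread (k := ↥(algebraicClosure ℚ ℂ)) (K := ℂ)
      (AbelianVariety.isSmoothProjective_holds (A := A))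
  letI : Algebra T ℂ := ψ₀.toAlgebra
  haveI : IsScalarTower (↥(algebraicClosure ℚ ℂ)) T ℂ :=
    IsScalarTower.of_algebraMap_eq fun x => (RingHom.congr_fun hψ₀ x).symm
  -- the model as a `T`-scheme
  let P : SchemeOver T := Over.mk g
  haveI : IsProper P.hom := hpr
  haveI := hsm
  haveI : Smooth P.hom := SmoothOfRelativeDimension.smooth A.dim g
  haveI : GeometricallyIrreducible P.hom := hgi
  haveI : QuasiCompact P.hom := inferInstance
  haveI : IsSeparated P.hom := inferInstance
  haveI : Flat P.hom := inferInstance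
  haveI : LocallyOfFinitePresentation P.hom := inferInstance
  -- `A ≅ Y ×_T Spec ℂ` as `ℂ`-schemes (both viewed in the category `Over (Spec ℂ)` of the limit `Spec ℂ = lim Spec T[t]`);
  -- the transported (commutative) group law on `Y ×_T Spec ℂ`
  let XA : Over (specOver T ℂ).left := A.X
  letI : GrpObj XA := A.grpObj
  haveI : IsCommMonObj XA := AbelianVariety.instIsCommMonObj A
  let e₁ : XA ≅ limObj ℂ P := Over.isoMk hpb.isoPullback hpb.isoPullback_hom_snd
  letI : GrpObj (limObj ℂ P) := GrpObj.ofIso e₁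
  haveI : IsCommMonObj (limObj ℂ P) := isCommMonObj_ofIso' e₁
  haveI : IsMonHom e₁.hom := isMonHom_ofIso e₁
  haveI : IsMonHom e₁.inv := inferInstance
  -- the transported action `ι_B a = e₁⁻¹ ∘ ι a ∘ e₁`
  let ιX : O → (XA ⟶ XA) := fun a => (ιA a).hom.hom.hom
  haveI hmonX : ∀ a, IsMonHom (ιX a) := fun a => (ιA a).hom.hom.isMonHom_hom
  let ιB : O → (limObj ℂ P ⟶ limObj ℂ P) := fun a => e₁.inv ≫ ιX a ≫ e₁.hom
  haveI hmonB : ∀ a, IsMonHom (ιB a) := fun a => by dsimp only [ιB]; infer_instance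
  have hX1 : ιX 1 = 𝟙 XA := by
    change (ιA 1).hom.hom.hom = 𝟙 A.X
    rw [ιA.map_one]; rfl
  have hXmul : ∀ a b, ιX (a * b) = ιX a ≫ ιX b := fun a b => by
    change (ιA (a * b)).hom.hom.hom = (ιA a).hom.hom.hom ≫ (ιA b).hom.hom.hom
    rw [mul_comm, ιA.map_mul, CategoryTheory.End.mul_def]; rfl
  have hXadd : ∀ a b, ιX (a + b) = ιX a * ιX b := fun a b => by
    change (ιA (a + b)).hom.hom.hom = (ιA a).hom.hom.hom * (ιA b).hom.hom.hom
    rw [ιA.map_add]; rfl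
  have h1 : ιB 1 = 𝟙 _ := by
    dsimp only [ιB]; rw [hX1, Category.id_comp, Iso.inv_hom_id]
  have hmul : ∀ a b, ιB (a * b) = ιB a ≫ ιB b := fun a b => by
    dsimp only [ιB]; rw [hXmul]; simp only [Category.assoc, Iso.hom_inv_id_assoc]
  have hadd : ∀ a b, ιB (a + b) = ιB a * ιB b := fun a b => by
    dsimp only [ιB]; rw [hXadd, MonObj.mul_comp, MonObj.comp_mul]
  -- descent of the group law and of the action to a stage
  obtain ⟨t₁, -, H⟩ := exists_stage_forall_grpObj_ringAction ℂ (∅ : Finset ℂ) P ιB h1 hmul hadd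
    (Opposite.op default)
  obtain ⟨G, ιt, hcomm, hmon, h1t, hmult, haddt, hiso, hkey⟩ := H t₁ (𝟙 _)
  -- the stage `T′ = T[t₁] ⊆ ℂ` and the abelian scheme
  letI : GrpObj (stageObj ℂ ∅ P t₁) := G
  let 𝒜 : AbelianScheme ↥(sub T ℂ t₁.unop.1) :=
    { X := stageObj ℂ ∅ P t₁
      isProper := inferInstanceAs (IsProper (pullback.snd P.hom ((baseDiagram T ℂ ∅).obj t₁).hom))
      isSmooth := inferInstanceAs (Smooth (pullback.snd P.hom ((baseDiagram T ℂ ∅).obj t₁).hom))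
      geometricallyConnected := by
        haveI : GeometricallyIrreducible (stageObj ℂ ∅ P t₁).hom :=
          inferInstanceAs (GeometricallyIrreducible (pullback.snd P.hom ((baseDiagram T ℂ ∅).obj t₁).hom))
        exact geometricallyConnected_of_geometricallyIrreducible _ }
  let ψ : ↥(sub T ℂ t₁.unop.1) →ₐ[algebraicClosure ℚ ℂ] ℂ := (sub T ℂ t₁.unop.1).val.restrictScalars _
  -- the fibre along `ψ` is `(Y_{t₁})_ℂ ≅ Y_ℂ ≅ A` (group structure induced by base change on the left, `A`'s on the right)
  letI : GrpObj ((legPullback T ℂ ∅ t₁).obj (stageObj ℂ ∅ P t₁)) :=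
    Functor.grpObjObj (F := legPullback T ℂ ∅ t₁) (G := stageObj ℂ ∅ P t₁)
  haveI : IsMonHom (legFacObjIso ℂ ∅ t₁ P).hom := hiso
  let eX' : (legPullback T ℂ ∅ t₁).obj (stageObj ℂ ∅ P t₁) ≅ XA := legFacObjIso ℂ ∅ t₁ P ≪≫ e₁.symm
  haveI hmonE : IsMonHom eX'.hom := by
    change IsMonHom ((legFacObjIso ℂ ∅ t₁ P).hom ≫ e₁.inv)
    infer_instance
  let eX : (𝒜.fibre ψ.toRingHom).X ≅ A.X := eX'
  haveI : IsMonHom eX.hom := hmonE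
  let e : 𝒜.fibre ψ.toRingHom ≅ A := InducedCategory.isoMk (Grp.mkIso' eX)
  refine ⟨↥(sub T ℂ t₁.unop.1), inferInstance, inferInstance, inferInstance,
    Algebra.FiniteType.trans (S := T) inferInstance inferInstance, ψ, Subtype.val_injective, 𝒜,
    ⟨ιt, hmon, h1t, hmult, haddt⟩, e, ?_, hcomm, fun a => ?_⟩
  · haveI := smoothOfRelativeDimension_isStableUnderBaseChange (n := A.dim)
    change SmoothOfRelativeDimension A.dim (pullback.snd P.hom ((baseDiagram T ℂ ∅).obj t₁).hom)
    exact MorphismProperty.pullback_snd _ _ hsm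
  apply AbelianVariety.hom_ext
  change (legPullback T ℂ ∅ t₁).map (ιt a) ≫ ((legFacObjIso ℂ ∅ t₁ P).hom ≫ e₁.inv) =
    ((legFacObjIso ℂ ∅ t₁ P).hom ≫ e₁.inv) ≫ ιX a
  rw [hkey a]
  simp only [ιB, Category.assoc, Iso.inv_hom_id_assoc, Iso.hom_inv_id, Category.comp_id]


end Literature.AlgebraicGeometry.AbelianSchemes.AbelianScheme

end
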